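import Literature.Algebra.Homology.GroupCohomologyGoodCoverFinite
import Literature.Algebra.Homology.GroupCohomologyFiniteType
import HarnessLib

/-!
# Brown's criterion, finite-type form: an equivariant good cover with free nerve gives cohomology
# of finite type (finitely generated values AND commutation with directed unions)

Topic `Algebra/Homology`; namespace `Literature.Algebra.Homology`.  Definitions with bodies (the
functorial pieces of the Čech coresolution, one `Type`-valued structure of data) and theorems; no
named fact, no instance, no `sorry`.  Sequel of `GroupCohomologyGoodCoverFinite` (finiteness for
FINITE coefficients) and `GroupCohomologyFiniteType`.

Let `S` act on a contractible space `X` with an invariant open cover `𝔘 = (U_i)` all of whose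
non-empty finite intersections are contractible, and suppose the nerve `N_a(𝔘)` is in each degree a
FREE `S`-set with a finite set `T_a` of orbit representatives (e.g. the cover by the translates of
finitely many prototypes with pairwise local finiteness, `GoodCoverFinite.nerve_bijective`,
`finite_nerveRep`).  The exact coresolution `0 → A → Fun(N₀, A) → Fun(N₁, A) → ⋯`
([Brown1982CohomologyGroups, VII §4, §7]) is FUNCTORIAL in the representation `A` (`funRepPost`,
`Zmap`, `SCmap`), its terms are acyclic — `Hᵇ⁺¹(S, Fun(N_a, A)) ≅ Hᵇ⁺¹(1, Fun(T_a, A)) = 0`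
(`funRepIsoCoind`, Shapiro) — and `H⁰(S, Fun(N_a, A)) = Fun(N_a, A)^S ↪ Fun(T_a, A)` is a finite
product of copies of `A`.  Dimension shifting along the short exact pieces
`0 → Z_a(A) → Fun(N_a, A) → Z_{a+1}(A) → 0` (the connecting maps are surjective, and bijective in
positive degrees; Mathlib `groupCohomology.δ`, `δ_naturality`, `epi_δ_of_isZero`) then proves, for
EVERY commutative ring `k` and every `k`-linear representation:

* `IsCohFiniteTypeUpTo k S 1` (`isCohFiniteTypeUpTo_one_of_freeGoodCover`): `Hⁿ(S, A)` is
  finitely generated for `A` finitely generated over Noetherian `k`, and `Hⁿ(S, -)` commutes with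
  directed unions of subrepresentations (both halves, multiplier `1`) — the two consequences of
  type `FP_∞` ([Brown1982CohomologyGroups, VIII (4.6), (4.8), VIII.4 Ex. 1]) that the integral
  comparison of [Scholze2015, §V.4] uses, obtained here WITHOUT a finite-type free resolution
  (no torsion-freeness of `S`, no free action, no compact quotient);
* `GoodTranslateCover S` — the data of such a witness in the form of
  `finite_groupCohomology_of_translateCover` (finitely many open prototypes, translates cover,
  contractible finite intersections, pairwise local finiteness), and
  `isCohFiniteTypeUpTo_one_of_goodTranslateCover`.

## References

* K. S. Brown, *Cohomology of Groups*, GTM 87 (1982), VII §4, VII (7.10), VIII §2, VIII (4.6),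
  (4.8). [Brown1982CohomologyGroups]
* R. Bott, L. W. Tu, *Differential Forms in Algebraic Topology*, GTM 82 (1982), Thm. 8.9, 15.8.
  [BottTu1982Forms]
* P. Scholze, Ann. of Math. 182 (2015), §V.4, proof of Thm. V.4.1. [Scholze2015]
-/

noncomputable section

open CategoryTheory CategoryTheory.Limits groupCohomology
open Literature.AlgebraicTopology.SingularHomology
open Literature.AlgebraicTopology.SingularHomology.CechNerve
open scoped Pointwise

universe u

namespace Literature.Algebra.Homology

variable {k : Type u} [CommRing k] {S : Type u} [Group S]

/-! ### Functoriality of `Fun(Y, A)` in the coefficients `A` -/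

section Post

variable {A B C : Rep.{u} k S} (Y : Type u) [MulAction S Y]

/-- **Postcomposition** `Fun(Y, A) ⟶ Fun(Y, B)`, `F ↦ f ∘ F`, for a morphism `f : A ⟶ B` of
representations (the functoriality of the coresolution `Fun(X_•, -)` in the coefficients).
[cite: Brown1982CohomologyGroups, VII §7] -/
def funRepPost (f : A ⟶ B) : funRep A Y ⟶ funRep B Y :=
  Rep.ofHom
    { toLinearMap := f.hom.toLinearMap.compLeft Y
      isIntertwining' := fun g => by
        refine LinearMap.ext fun F => funext fun y => ?_
        change f.hom (funRepr A.ρ Y g F y) = B.ρ g (f.hom (F (g⁻¹ • y)))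
        rw [funRepr_apply, Rep.hom_comm_apply] }

/-- Unfolding lemma: `(f ∘ F)(y) = f (F y)`. [folklore] -/
@[simp]
theorem funRepPost_hom_apply (f : A ⟶ B) (F : funRep A Y) (y : Y) :
    ((funRepPost Y f).hom F : Y → B) y = f.hom ((F : Y → A) y) :=
  rfl

/-- Postcomposition by an injective morphism is injective. [folklore] -/
theorem funRepPost_injective (f : A ⟶ B) (hf : Function.Injective f.hom) :
    Function.Injective (funRepPost Y f).hom := by
  intro F F' h
  funext y
  apply hf
  have h' := congrFun h y
  rwa [funRepPost_hom_apply, funRepPost_hom_apply] at h'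

/-- Postcomposition is compatible with composition. [folklore] -/
theorem funRepPost_comp (f : A ⟶ B) (g : B ⟶ C) :
    funRepPost Y (f ≫ g) = funRepPost Y f ≫ funRepPost Y g :=
  Rep.hom_ext (Representation.IntertwiningMap.ext (LinearMap.ext fun _ => funext fun _ => rfl))

/-- Postcomposition commutes with the constants `A ⟶ Fun(Y, A)`. [folklore] -/
theorem funRepConst_funRepPost (f : A ⟶ B) :
    funRepConst A Y ≫ funRepPost Y f = f ≫ funRepConst B Y :=
  Rep.hom_ext (Representation.IntertwiningMap.ext (LinearMap.ext fun _ => funext fun _ => rfl))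

end Post

/-! ### Invariant functions on a free `S`-set with finitely many orbits -/

section Invariants

variable (A : Rep.{u} k S) (Y : Type u) [MulAction S Y] {T : Type u} (t : T → Y)
  (hbij : Function.Bijective fun p : S × T => p.1 • t p.2)

/-- An invariant function satisfies `F(g • y) = ρ(g) F(y)`. [folklore] -/
theorem apply_smul_of_mem_invariants {F : Y → A} (hF : F ∈ (funRep A Y).ρ.invariants) (g : S)
    (y : Y) : F (g • y) = A.ρ g (F y) := by
  have h := (Representation.mem_invariants _ _).1 hF g
  have h2 : funRepr A.ρ Y g F = F := h
  have h' := congrFun h2 (g • y)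
  rw [funRepr_apply, inv_smul_smul] at h'
  exact h'.symm

/-- A function with `F(g • y) = ρ(g) F(y)` is invariant. [folklore] -/
theorem mem_invariants_of_apply_smul {F : Y → A} (hF : ∀ (g : S) (y : Y), F (g • y) = A.ρ g (F y)) :
    F ∈ (funRep A Y).ρ.invariants :=
  (Representation.mem_invariants _ _).2 fun g => funext fun y => by
    change A.ρ g (F (g⁻¹ • y)) = F y
    rw [← hF, smul_inv_smul]

include hbij in
/-- **An invariant function on a free `S`-set is determined by its values on a section.**
[cite: Brown1982CohomologyGroups, III (5.9)] -/
theorem eq_of_mem_invariants_of_forall_eq {F F' : Y → A} (hF : F ∈ (funRep A Y).ρ.invariants)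
    (hF' : F' ∈ (funRep A Y).ρ.invariants) (h : ∀ r : T, F (t r) = F' (t r)) : F = F' := by
  funext y
  obtain ⟨⟨g, r⟩, rfl⟩ := hbij.2 y
  change F (g • t r) = F' (g • t r)
  rw [apply_smul_of_mem_invariants A Y hF, apply_smul_of_mem_invariants A Y hF', h]

variable {A} {B : Rep.{u} k S}

include hbij in
/-- **Lifting an invariant function along a directed union.**  If `Y` is a free `S`-set with a
FINITE section `T` and `B = ⋃ A_i` is a directed union of subrepresentations, every invariant
`F : Y → B` is `φ_i ∘ F'` for an invariant `F' : Y → A_i` (its finitely many values on the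
section lie in a common `A_i`, and `F(g • t) = ρ(g) F(t)`). [cite: Brown1982CohomologyGroups, VIII (4.8)] -/
theorem exists_lift_of_mem_invariants [Finite T] (D : DirectedSubrepSystem k S) {F : Y → D.B}
    (hF : F ∈ (funRep D.B Y).ρ.invariants) :
    ∃ i, ∃ F' : Y → D.A i, F' ∈ (funRep (D.A i) Y).ρ.invariants ∧ ∀ y, (D.φ i).hom (F' y) = F y := by
  classical
  have hval : ∀ r : T, ∃ i, ∃ a : D.A i, (D.φ i).hom a = F (t r) := fun r => D.exhaust _
  choose i₀ a₀ ha₀ using hval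
  obtain ⟨i, hi⟩ := Finite.exists_le i₀
  have hmem : ∀ y : Y, ∃ a : D.A i, (D.φ i).hom a = F y := by
    intro y
    obtain ⟨⟨g, r⟩, rfl⟩ := hbij.2 y
    refine ⟨(D.A i).ρ g ((D.t (hi r)).hom (a₀ r)), ?_⟩
    change _ = F (g • t r)
    rw [Rep.hom_comm_apply, D.φ_t_apply, ha₀ r, apply_smul_of_mem_invariants D.B Y hF]
  choose a ha using hmem
  refine ⟨i, a, mem_invariants_of_apply_smul (D.A i) Y fun g y => ?_, ha⟩
  apply D.injective i
  rw [ha, Rep.hom_comm_apply, ha, apply_smul_of_mem_invariants D.B Y hF]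

end Invariants

/-! ### `H⁰` bookkeeping -/

section HZero

variable {A B : Rep.{u} k S}

/-- Element form of the naturality of `H0Iso`: `(H0Iso B (H⁰(f) x)).1 = f ((H0Iso A x).1)`.
[folklore] -/
theorem H0Iso_hom_map_apply_coe (f : A ⟶ B) (x : groupCohomology A 0) :
    ((H0Iso B).hom (groupCohomology.map (MonoidHom.id S) f 0 x) : B) = f.hom ((H0Iso A).hom x : A) := by
  have h := congrArg (fun F => ((F : groupCohomology A 0 ⟶ _) x : B)) (map_id_comp_H0Iso_hom f)
  change (((H0Iso B).hom (groupCohomology.map (MonoidHom.id S) f 0 x)) : B) =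
    Subtype.val (((Rep.invariantsFunctor k S).map f ((H0Iso A).hom x) : B.ρ.invariants)) at h
  rw [h]
  rfl

/-- **Recognising `H⁰(f)`-preimages through invariants**: if `a' ∈ A^S` maps under `f` to the
invariant of `x ∈ H⁰(S, B)`, then `H⁰(f) ((H0Iso A)⁻¹ a') = x`. [folklore] -/
theorem map_H0Iso_inv_eq (f : A ⟶ B) (x : groupCohomology B 0) (a' : A.ρ.invariants)
    (h : f.hom (a' : A) = ((H0Iso B).hom x : B)) :
    groupCohomology.map (MonoidHom.id S) f 0 ((H0Iso A).inv a') = x := by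
  apply (H0Iso B).toLinearEquiv.injective
  change (H0Iso B).hom _ = (H0Iso B).hom x
  apply Subtype.ext
  rw [H0Iso_hom_map_apply_coe, iso_hom_inv_apply]
  exact h

/-- `H⁰(f)` is injective for `f` injective. [folklore] -/
theorem map_zero_injective (f : A ⟶ B) (hf : Function.Injective f.hom) :
    Function.Injective (groupCohomology.map (MonoidHom.id S) f 0) := by
  haveI : Mono f := (Rep.mono_iff_injective f).2 hf
  exact (ModuleCat.mono_iff_injective (groupCohomology.map (MonoidHom.id S) f 0)).1 inferInstance

end HZero

/-! ### The functorial Čech coresolution and its pieces -/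

section Cech

variable {X : Type u} [MulAction S X] {ι : Type u} [MulAction S ι] (U : ι → Set X)
  [IsInvariantFamily S U]

/-- Postcomposition commutes with the Čech differential. [cite: Brown1982CohomologyGroups, VII §7] -/
theorem funRepPost_cechRepD {A B : Rep.{u} k S} (f : A ⟶ B) (a : ℕ) :
    funRepPost (Nerve U a) f ≫ cechRepD U B a = cechRepD U A a ≫ funRepPost (Nerve U (a + 1)) f := by
  refine Rep.hom_ext (Representation.IntertwiningMap.ext (LinearMap.ext fun F => funext fun J => ?_))
  change cechFunD k B U a ((funRepPost (Nerve U a) f).hom F) J =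
    f.hom (cechFunD k A U a F J)
  rw [cechFunD_apply, cechFunD_apply, map_sum]
  refine Finset.sum_congr rfl fun j _ => ?_
  rw [map_smul, funRepPost_hom_apply]

variable (A : Rep.{u} k S)

/-- The cocycles `Z_a(A) = ker (d_a : Fun(N_a, A) → Fun(N_{a+1}, A))` as a subrepresentation.
[cite: Brown1982CohomologyGroups, VII (7.10)] -/
abbrev Zrep (a : ℕ) : Rep.{u} k S :=
  Rep.subrepresentation (funRep A (Nerve U a)) (LinearMap.ker (cechRepD U A a).hom.toLinearMap)
    fun g => ker_le_comap_of_hom (cechRepD U A a) g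

/-- The inclusion `Z_a(A) ⟶ Fun(N_a, A)`. [folklore] -/
def Zι (a : ℕ) : Zrep U A a ⟶ funRep A (Nerve U a) :=
  Rep.subtype (funRep A (Nerve U a)) (LinearMap.ker (cechRepD U A a).hom.toLinearMap)
    fun g => ker_le_comap_of_hom (cechRepD U A a) g

/-- `(Zι z : Fun) = z.1`. [folklore] -/
@[simp]
theorem Zι_hom_apply (a : ℕ) (z : Zrep U A a) : (Zι U A a).hom z = z.1 :=
  rfl

/-- `d (d F) = 0` for the representation-level Čech differential. [folklore] -/
theorem cechRepD_cechRepD_apply (a : ℕ) (F : funRep A (Nerve U a)) :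
    (cechRepD U A (a + 1)).hom ((cechRepD U A a).hom F) = 0 :=
  cechFunD_cechFunD (R := k) (M := A) (U := U) F

/-- The corestriction `Fun(N_a, A) ⟶ Z_{a+1}(A)` of `d_a`. [folklore] -/
def Zπ (a : ℕ) : funRep A (Nerve U a) ⟶ Zrep U A (a + 1) :=
  Rep.ofHom
    { toLinearMap := LinearMap.codRestrict _ (cechRepD U A a).hom.toLinearMap fun F =>
        cechRepD_cechRepD_apply U A a F
      isIntertwining' := fun g => by
        refine LinearMap.ext fun F => Subtype.ext ?_
        exact Rep.hom_comm_apply (cechRepD U A a) g F }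

/-- `(Zπ F).1 = d F`. [folklore] -/
@[simp]
theorem Zπ_hom_apply_coe (a : ℕ) (F : funRep A (Nerve U a)) :
    ((Zπ U A a).hom F).1 = (cechRepD U A a).hom F :=
  rfl

/-- `Zι ≫ Zπ = 0`. [folklore] -/
theorem Zι_Zπ (a : ℕ) : Zι U A a ≫ Zπ U A a = 0 := by
  refine Rep.hom_ext (Representation.IntertwiningMap.ext (LinearMap.ext fun z => ?_))
  apply Subtype.ext
  change (cechRepD U A a).hom ((Zι U A a).hom z) = 0
  exact z.2

/-- The short complex `Z_a(A) → Fun(N_a, A) → Z_{a+1}(A)`. [cite: Brown1982CohomologyGroups, VII (7.10)] -/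
abbrev ZSC (a : ℕ) : ShortComplex (Rep.{u} k S) :=
  ShortComplex.mk (Zι U A a) (Zπ U A a) (Zι_Zπ U A a)

/-- **The pieces of the Čech coresolution are short exact** for a good open cover of a
contractible space (Leray: `cechFunD_exact_succ`). [cite: BottTu1982Forms, Thm. 8.9 and 15.8]
[cite: Brown1982CohomologyGroups, VII §4] -/
theorem ZSC_shortExact [TopologicalSpace X] [ContractibleSpace X] (hU : ∀ i, IsOpen (U i))
    (hcov : (Set.univ : Set X) ⊆ ⋃ i, U i)
    (hgood : ∀ (p : ℕ) (J : Fin (p + 1) → ι), (cechSet U J).Nonempty → ContractibleSpace ↥(cechSet U J))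
    (a : ℕ) : (ZSC U A a).ShortExact := by
  refine shortExact_of_function_exact _ ?_ ?_ ?_
  · exact Subtype.val_injective
  · intro z
    obtain ⟨F, hF⟩ := (cechFunD_exact_succ (R := k) (M := A) (U := U) hU hcov hgood a z.1).1 z.2
    exact ⟨F, Subtype.ext hF⟩
  · intro F
    change (Zπ U A a).hom F = 0 ↔ F ∈ Set.range (Zι U A a).hom
    constructor
    · intro hF
      have hF' : (cechRepD U A a).hom F = 0 := by
        rw [← Zπ_hom_apply_coe, hF]
        rfl
      exact ⟨⟨F, hF'⟩, rfl⟩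
    · rintro ⟨z, rfl⟩
      exact Subtype.ext z.2

variable {A} {B C : Rep.{u} k S}

/-- Element form of `funRepPost_cechRepD`. [folklore] -/
theorem cechRepD_funRepPost_apply (f : A ⟶ B) (a : ℕ) (F : funRep A (Nerve U a)) :
    (cechRepD U B a).hom ((funRepPost (Nerve U a) f).hom F) =
      (funRepPost (Nerve U (a + 1)) f).hom ((cechRepD U A a).hom F) := by
  have h := congrArg (fun φ => φ.hom F) (funRepPost_cechRepD U f a)
  simpa [Rep.hom_comp] using h

/-- **Functoriality of the cocycles**: `Z_a(f) : Z_a(A) ⟶ Z_a(B)`. [cite: Brown1982CohomologyGroups, VII §7] -/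
def Zmap (f : A ⟶ B) (a : ℕ) : Zrep U A a ⟶ Zrep U B a :=
  Rep.ofHom
    { toLinearMap := LinearMap.codRestrict _
        ((funRepPost (Nerve U a) f).hom.toLinearMap ∘ₗ (Zι U A a).hom.toLinearMap) fun z => by
          change (cechRepD U B a).hom ((funRepPost (Nerve U a) f).hom ((Zι U A a).hom z)) = 0
          have hz : (cechRepD U A a).hom ((Zι U A a).hom z) = 0 := z.2
          rw [cechRepD_funRepPost_apply, hz, map_zero]
      isIntertwining' := fun g => by
        refine LinearMap.ext fun z => Subtype.ext ?_
        exact Rep.hom_comm_apply (Zι U A a ≫ funRepPost (Nerve U a) f) g z }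

/-- `(Z_a(f) z).1 = f ∘ z.1`. [folklore] -/
@[simp]
theorem Zmap_hom_apply_coe (f : A ⟶ B) (a : ℕ) (z : Zrep U A a) :
    ((Zmap U f a).hom z).1 = (funRepPost (Nerve U a) f).hom z.1 :=
  rfl

/-- `Z(f)` commutes with the inclusions. [folklore] -/
theorem Zmap_Zι (f : A ⟶ B) (a : ℕ) : Zmap U f a ≫ Zι U B a = Zι U A a ≫ funRepPost (Nerve U a) f :=
  Rep.hom_ext (Representation.IntertwiningMap.ext (LinearMap.ext fun _ => rfl))

/-- `Z(f)` commutes with the corestricted differentials. [folklore] -/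
theorem Zπ_Zmap (f : A ⟶ B) (a : ℕ) :
    Zπ U A a ≫ Zmap U f (a + 1) = funRepPost (Nerve U a) f ≫ Zπ U B a := by
  refine Rep.hom_ext (Representation.IntertwiningMap.ext (LinearMap.ext fun F => ?_))
  apply Subtype.ext
  change (funRepPost (Nerve U (a + 1)) f).hom ((cechRepD U A a).hom F) =
    (cechRepD U B a).hom ((funRepPost (Nerve U a) f).hom F)
  rw [cechRepD_funRepPost_apply]

/-- `Z` is a functor: `Z(f ≫ g) = Z(f) ≫ Z(g)`. [folklore] -/
theorem Zmap_comp (f : A ⟶ B) (g : B ⟶ C) (a : ℕ) : Zmap U (f ≫ g) a = Zmap U f a ≫ Zmap U g a :=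
  Rep.hom_ext (Representation.IntertwiningMap.ext (LinearMap.ext fun _ => Subtype.ext (funext fun _ => rfl)))

/-- `Z(f)` is injective for `f` injective. [folklore] -/
theorem Zmap_injective (f : A ⟶ B) (hf : Function.Injective f.hom) (a : ℕ) :
    Function.Injective (Zmap U f a).hom := by
  intro z z' h
  apply Subtype.ext
  exact funRepPost_injective (Nerve U a) f hf (congrArg Subtype.val h)

/-- **The morphism of short exact pieces induced by `f : A ⟶ B`.**
[cite: Brown1982CohomologyGroups, VII §7] -/
def ZSCmap (f : A ⟶ B) (a : ℕ) : ZSC U A a ⟶ ZSC U B a :=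
  ShortComplex.homMk (Zmap U f a) (funRepPost (Nerve U a) f) (Zmap U f (a + 1))
    (Zmap_Zι U f a) (Zπ_Zmap U f a).symm

variable (A)

/-- The coaugmentation `A ⟶ Z₀(A)` (constants are cocycles). [cite: BottTu1982Forms, Thm. 8.9] -/
def Zε : A ⟶ Zrep U A 0 :=
  Rep.ofHom
    { toLinearMap := LinearMap.codRestrict _ (funRepConst A (Nerve U 0)).hom.toLinearMap fun m =>
        cechFunD_cechFunCoaug (R := k) (M := A) (U := U) m
      isIntertwining' := fun g => by
        refine LinearMap.ext fun m => Subtype.ext ?_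
        exact Rep.hom_comm_apply (funRepConst A (Nerve U 0)) g m }

/-- `(Zε m).1` is the constant function `m`. [folklore] -/
@[simp]
theorem Zε_hom_apply_coe (m : A) :
    ((Zε U A).hom m).1 = (funRepConst A (Nerve U 0)).hom m :=
  rfl

variable {A}

/-- Naturality of the coaugmentation. [folklore] -/
theorem Zε_naturality (f : A ⟶ B) : f ≫ Zε U B = Zε U A ≫ Zmap U f 0 :=
  Rep.hom_ext (Representation.IntertwiningMap.ext (LinearMap.ext fun _ =>
    Subtype.ext (funext fun _ => rfl)))

variable (A)

/-- **`A ≅ Z₀(A)`**: the coaugmentation is bijective for an open cover of a (non-empty,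
connected) contractible space (`cechFunCoaug_injective`, `cechFunCoaug_exact`).
[cite: BottTu1982Forms, Prop. 8.5] -/
theorem Zε_bijective [TopologicalSpace X] [ContractibleSpace X] (hU : ∀ i, IsOpen (U i))
    (hcov : (Set.univ : Set X) ⊆ ⋃ i, U i) : Function.Bijective (Zε U A).hom := by
  haveI : Nonempty X := inferInstance
  constructor
  · intro m m' h
    exact cechFunCoaug_injective (R := k) (M := A) (U := U) hcov (congrArg Subtype.val h)
  · intro z
    obtain ⟨m, hm⟩ := (cechFunCoaug_exact (R := k) (M := A) (U := U) hU hcov z.1).1 z.2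
    exact ⟨m, Subtype.ext hm⟩

/-- The coaugmentation is an isomorphism. [folklore] -/
theorem isIso_Zε [TopologicalSpace X] [ContractibleSpace X] (hU : ∀ i, IsOpen (U i))
    (hcov : (Set.univ : Set X) ⊆ ⋃ i, U i) : IsIso (Zε U A) := by
  haveI : IsIso ((forget (Rep k S)).map (Zε U A)) := (isIso_iff_bijective _).2 (Zε_bijective U A hU hcov)
  exact isIso_of_reflects_iso (Zε U A) (forget (Rep k S))

end Cech

/-! ### Acyclicity of the terms and element-form naturalities -/

section Acyclic

/-- **`Hᵇ⁺¹(S, Fun(Y, A)) = 0` for a free `S`-set `Y`** (`Fun(Y, A) ≅ Coind_1^S Fun(T, A)` and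
Shapiro). [cite: Brown1982CohomologyGroups, III (5.9), (6.2)] -/
theorem isZero_groupCohomology_funRep_succ (A : Rep.{u} k S) (Y : Type u) [MulAction S Y]
    {T : Type u} (t : T → Y) (hbij : Function.Bijective fun p : S × T => p.1 • t p.2) (b : ℕ) :
    IsZero (groupCohomology (funRep A Y) (b + 1)) :=
  IsZero.of_iso (isZero_groupCohomology_succ_of_subsingleton (orbitCoeff (k := k) A T) b)
    ((groupCohomology.functor k S (b + 1)).mapIso (funRepIsoCoind A Y t hbij) ≪≫
      groupCohomology.coindIso (orbitCoeff (k := k) A T) (b + 1))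

variable {A B C D' : Rep.{u} k S}

/-- `Hⁿ(g) (Hⁿ(f) x) = Hⁿ(g') (Hⁿ(f') x)` when `f ≫ g = f' ≫ g'`. [folklore] -/
theorem map_map_eq_of_comp_eq {f : A ⟶ B} {g : B ⟶ D'} {f' : A ⟶ C} {g' : C ⟶ D'}
    (h : f ≫ g = f' ≫ g') (n : ℕ) (x : groupCohomology A n) :
    groupCohomology.map (MonoidHom.id S) g n (groupCohomology.map (MonoidHom.id S) f n x) =
      groupCohomology.map (MonoidHom.id S) g' n (groupCohomology.map (MonoidHom.id S) f' n x) := by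
  have h' := congrArg (fun F => (groupCohomology.map (MonoidHom.id S) F n : groupCohomology A n ⟶ _) x) h
  simp only [groupCohomology.map_id_comp, ModuleCat.comp_apply] at h'
  exact h'

/-- `Hⁿ(g) (Hⁿ(f) x) = Hⁿ(h) x` when `f ≫ g = h`. [folklore] -/
theorem map_map_eq_of_comp_eq' {f : A ⟶ B} {g : B ⟶ C} {h : A ⟶ C} (hc : f ≫ g = h) (n : ℕ)
    (x : groupCohomology A n) :
    groupCohomology.map (MonoidHom.id S) g n (groupCohomology.map (MonoidHom.id S) f n x) =
      groupCohomology.map (MonoidHom.id S) h n x := by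
  have h' := congrArg (fun F => (groupCohomology.map (MonoidHom.id S) F n : groupCohomology A n ⟶ _) x) hc
  simp only [groupCohomology.map_id_comp, ModuleCat.comp_apply] at h'
  exact h'

/-- Element form of `groupCohomology.δ_naturality`. [folklore] -/
theorem δ_map_apply {X1 X2 : ShortComplex (Rep.{u} k S)} (hX1 : X1.ShortExact) (hX2 : X2.ShortExact)
    (F : X1 ⟶ X2) (b : ℕ) (w : groupCohomology X1.X₃ b) :
    groupCohomology.map (MonoidHom.id S) F.τ₁ (b + 1) (δ hX1 b (b + 1) rfl w) =
      δ hX2 b (b + 1) rfl (groupCohomology.map (MonoidHom.id S) F.τ₃ b w) := by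
  have h := congrArg (fun T => (T : groupCohomology X1.X₃ b ⟶ _) w) (δ_naturality hX1 hX2 F b (b + 1) rfl)
  simpa only [ModuleCat.comp_apply] using h

/-- `δ ∘ Hᵇ(g) = 0` in the long exact sequence, element form. [folklore] -/
theorem δ_map_g_apply {X1 : ShortComplex (Rep.{u} k S)} (hX1 : X1.ShortExact) (b : ℕ)
    (u : groupCohomology X1.X₂ b) :
    δ hX1 b (b + 1) rfl (groupCohomology.map (MonoidHom.id S) X1.g b u) = 0 := by
  have h0 : groupCohomology.map (MonoidHom.id S) X1.g b ≫ δ hX1 b (b + 1) rfl = 0 :=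
    (mapShortComplex₃ hX1 rfl).zero
  change (groupCohomology.map (MonoidHom.id S) X1.g b ≫ δ hX1 b (b + 1) rfl) u = 0
  rw [h0]
  rfl

/-- Exactness of `Hᵇ(X₂) → Hᵇ(X₃) →δ→ Hᵇ⁺¹(X₁)`, element form. [folklore] -/
theorem exists_map_g_eq_of_δ_eq_zero {X1 : ShortComplex (Rep.{u} k S)} (hX1 : X1.ShortExact) (b : ℕ)
    (w : groupCohomology X1.X₃ b) (hw : δ hX1 b (b + 1) rfl w = 0) :
    ∃ u : groupCohomology X1.X₂ b, groupCohomology.map (MonoidHom.id S) X1.g b u = w := by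
  obtain ⟨u, hu⟩ := (ShortComplex.moduleCat_exact_iff _).1 (mapShortComplex₃_exact hX1 (rfl : b + 1 = b + 1)) w hw
  exact ⟨u, hu⟩

/-- Surjectivity of `δ : Hᵇ(X₃) → Hᵇ⁺¹(X₁)` when `Hᵇ⁺¹(X₂) = 0`. [folklore] -/
theorem δ_surjective_of_isZero {X1 : ShortComplex (Rep.{u} k S)} (hX1 : X1.ShortExact) (b : ℕ)
    (h : IsZero (groupCohomology X1.X₂ (b + 1))) : Function.Surjective (δ hX1 b (b + 1) rfl) := by
  haveI := epi_δ_of_isZero hX1 b h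
  exact (ModuleCat.epi_iff_surjective _).1 inferInstance

end Acyclic

/-! ### Dimension shifting along the functorial coresolution -/

section Main

variable {X : Type u} [MulAction S X] {ι : Type u} [MulAction S ι] (U : ι → Set X)
  [IsInvariantFamily S U] [TopologicalSpace X] [ContractibleSpace X]
  (hU : ∀ i, IsOpen (U i)) (hcov : (Set.univ : Set X) ⊆ ⋃ i, U i)
  (hgood : ∀ (p : ℕ) (J : Fin (p + 1) → ι), (cechSet U J).Nonempty → ContractibleSpace ↥(cechSet U J))
  {T : ℕ → Type u} (t : ∀ a, T a → Nerve U a)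
  (hbij : ∀ a, Function.Bijective fun p : S × T a => p.1 • t a p.2) [∀ a, Finite (T a)]

omit [TopologicalSpace X] [ContractibleSpace X] in
include hbij in
/-- **Lifting `H⁰(S, Fun(N_a, -))` along a directed union.** [cite: Brown1982CohomologyGroups, VIII (4.8)] -/
theorem exists_map_funRepPost_zero_eq (D : DirectedSubrepSystem k S) (a : ℕ)
    (u : groupCohomology (funRep D.B (Nerve U a)) 0) :
    ∃ j, ∃ u' : groupCohomology (funRep (D.A j) (Nerve U a)) 0,
      groupCohomology.map (MonoidHom.id S) (funRepPost (Nerve U a) (D.φ j)) 0 u' = u := by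
  let F : (funRep D.B (Nerve U a)).ρ.invariants := (H0Iso _).hom u
  obtain ⟨j, F', hF', hF'eq⟩ := exists_lift_of_mem_invariants (Nerve U a) (t a) (hbij a) D F.2
  exact ⟨j, (H0Iso _).inv ⟨F', hF'⟩,
    map_H0Iso_inv_eq (funRepPost (Nerve U a) (D.φ j)) u ⟨F', hF'⟩ (funext fun J => hF'eq J)⟩

omit [TopologicalSpace X] [ContractibleSpace X] in
include hbij in
/-- **Lifting `H⁰(S, Z_a(-))` along a directed union.** [cite: Brown1982CohomologyGroups, VIII (4.8)] -/
theorem exists_map_Zmap_zero_eq (D : DirectedSubrepSystem k S) (a : ℕ)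
    (x : groupCohomology (Zrep U D.B a) 0) :
    ∃ i, ∃ y : groupCohomology (Zrep U (D.A i) a) 0,
      groupCohomology.map (MonoidHom.id S) (Zmap U (D.φ i) a) 0 y = x := by
  let z : (Zrep U D.B a).ρ.invariants := (H0Iso _).hom x
  -- the underlying invariant function `N_a → B`
  have hzinv : ((z : Zrep U D.B a).1 : funRep D.B (Nerve U a)) ∈ (funRep D.B (Nerve U a)).ρ.invariants := by
    rw [Representation.mem_invariants]
    intro g
    have h := (Representation.mem_invariants _ _).1 z.2 g
    have h' := congrArg (fun w : Zrep U D.B a => (Zι U D.B a).hom w) h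
    rw [Rep.hom_comm_apply] at h'
    exact h'
  obtain ⟨i, F', hF', hF'eq⟩ := exists_lift_of_mem_invariants (Nerve U a) (t a) (hbij a) D hzinv
  -- `F'` is a cocycle: `φ_i ∘ d F' = d (φ_i ∘ F') = 0`
  have hF'ker : (cechRepD U (D.A i) a).hom F' = 0 := by
    apply funRepPost_injective (Nerve U (a + 1)) (D.φ i) (D.injective i)
    rw [map_zero, ← cechRepD_funRepPost_apply]
    have heq : (funRepPost (Nerve U a) (D.φ i)).hom F' = (z : Zrep U D.B a).1 :=
      funext fun J => hF'eq J
    rw [heq]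
    exact (z : Zrep U D.B a).2
  let z' : Zrep U (D.A i) a := ⟨F', hF'ker⟩
  have hz'inv : z' ∈ (Zrep U (D.A i) a).ρ.invariants := by
    rw [Representation.mem_invariants]
    intro g
    apply Subtype.ext
    change (funRep (D.A i) (Nerve U a)).ρ g F' = F'
    exact (Representation.mem_invariants _ _).1 hF' g
  refine ⟨i, (H0Iso _).inv ⟨z', hz'inv⟩, map_H0Iso_inv_eq (Zmap U (D.φ i) a) x ⟨z', hz'inv⟩ ?_⟩
  apply Subtype.ext
  exact funext fun J => hF'eq J

include hU hcov hgood hbij in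
/-- **Dimension shifting, both halves of (U) for all pieces `Z_a` at once.**  For a directed union
`B = ⋃ A_i` of representations: every class of `Hᵇ(S, Z_a(B))` comes from some `Hᵇ(S, Z_a(A_i))`,
and a class of `Hᵇ(S, Z_a(A_i))` dying in `Hᵇ(S, Z_a(B))` dies in some `Hᵇ(S, Z_a(A_j))`.
Induction on `b` for all `a`: `δ : Hᵇ(Z_{a+1}) ↠ Hᵇ⁺¹(Z_a)` is surjective and natural, and the
image of `Hᵇ(Fun(N_a, B))` is `0` for `b ≥ 1` and lifts to a finite stage for `b = 0`.
[cite: Brown1982CohomologyGroups, VII (7.10), VIII (4.8)] -/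
theorem surj_and_inj_Zrep (D : DirectedSubrepSystem k S) : ∀ (b a : ℕ),
    (∀ x : groupCohomology (Zrep U D.B a) b, ∃ i, ∃ y : groupCohomology (Zrep U (D.A i) a) b,
        groupCohomology.map (MonoidHom.id S) (Zmap U (D.φ i) a) b y = x) ∧
    (∀ (i : D.ι) (y : groupCohomology (Zrep U (D.A i) a) b),
        groupCohomology.map (MonoidHom.id S) (Zmap U (D.φ i) a) b y = 0 →
        ∃ j, ∃ h : i ≤ j, groupCohomology.map (MonoidHom.id S) (Zmap U (D.t h) a) b y = 0) := by
  have hZ : ∀ (E : Rep.{u} k S) (a : ℕ), (ZSC U E a).ShortExact := fun E a =>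
    ZSC_shortExact U E hU hcov hgood a
  intro b
  induction b with
  | zero =>
    intro a
    refine ⟨exists_map_Zmap_zero_eq U t hbij D a, fun i y hy => ⟨i, le_rfl, ?_⟩⟩
    have hy0 : y = 0 :=
      map_zero_injective (Zmap U (D.φ i) a) (Zmap_injective U (D.φ i) (D.injective i) a)
        (by rw [hy, map_zero])
    rw [hy0, map_zero]
  | succ b ih =>
    intro a
    obtain ⟨ihS, ihI⟩ := ih (a + 1)
    constructor
    · -- surjectivity in degree `b + 1`
      intro x
      obtain ⟨w, rfl⟩ := δ_surjective_of_isZero (hZ D.B a) b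
        (isZero_groupCohomology_funRep_succ D.B (Nerve U a) (t a) (hbij a) b) x
      obtain ⟨i, wi, hwi⟩ := ihS w
      refine ⟨i, δ (hZ (D.A i) a) b (b + 1) rfl wi, ?_⟩
      have hnat := δ_map_apply (hZ (D.A i) a) (hZ D.B a) (ZSCmap U (D.φ i) a) b wi
      exact hnat.trans (congrArg (δ (hZ D.B a) b (b + 1) rfl) hwi)
    · -- injectivity in degree `b + 1`
      intro i y hy
      obtain ⟨w, rfl⟩ := δ_surjective_of_isZero (hZ (D.A i) a) b
        (isZero_groupCohomology_funRep_succ (D.A i) (Nerve U a) (t a) (hbij a) b) y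
      have hnat : ∀ {E E' : Rep.{u} k S} (f : E ⟶ E') (v : groupCohomology (Zrep U E (a + 1)) b),
          groupCohomology.map (MonoidHom.id S) (Zmap U f a) (b + 1) (δ (hZ E a) b (b + 1) rfl v) =
            δ (hZ E' a) b (b + 1) rfl (groupCohomology.map (MonoidHom.id S) (Zmap U f (a + 1)) b v) :=
        fun f v => δ_map_apply (hZ _ a) (hZ _ a) (ZSCmap U f a) b v
      have h1 : δ (hZ D.B a) b (b + 1) rfl
          (groupCohomology.map (MonoidHom.id S) (Zmap U (D.φ i) (a + 1)) b w) = 0 :=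
        (hnat (D.φ i) w).symm.trans hy
      obtain ⟨u, hu⟩ := exists_map_g_eq_of_δ_eq_zero (hZ D.B a) b _ h1
      change groupCohomology.map (MonoidHom.id S) (Zπ U D.B a) b u =
        groupCohomology.map (MonoidHom.id S) (Zmap U (D.φ i) (a + 1)) b w at hu
      cases b with
      | zero =>
        -- lift `u ∈ H⁰(Fun(N_a, B))` to a finite stage
        obtain ⟨j₀, u', hu'⟩ := exists_map_funRepPost_zero_eq U t hbij D a u
        obtain ⟨j, hij, hj₀j⟩ := @directed_of D.ι (· ≤ ·) D.isDirected i j₀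
        have key : groupCohomology.map (MonoidHom.id S) (Zmap U (D.φ j) (a + 1)) 0
            (groupCohomology.map (MonoidHom.id S) (Zmap U (D.t hij) (a + 1)) 0 w) =
            groupCohomology.map (MonoidHom.id S) (Zmap U (D.φ j) (a + 1)) 0
              (groupCohomology.map (MonoidHom.id S) (Zπ U (D.A j) a) 0
                (groupCohomology.map (MonoidHom.id S) (funRepPost (Nerve U a) (D.t hj₀j)) 0 u')) := by
          rw [map_map_eq_of_comp_eq' (by rw [← Zmap_comp, D.t_comp]) 0 w,
            map_map_eq_of_comp_eq (Zπ_Zmap U (D.φ j) a) 0,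
            map_map_eq_of_comp_eq' (by rw [← funRepPost_comp, D.t_comp]) 0 u', hu', hu]
        have heq := map_zero_injective (Zmap U (D.φ j) (a + 1))
          (Zmap_injective U (D.φ j) (D.injective j) (a + 1)) key
        refine ⟨j, hij, (hnat (D.t hij) w).trans ?_⟩
        exact (congrArg (δ (hZ (D.A j) a) 0 (0 + 1) rfl) heq).trans (δ_map_g_apply (hZ (D.A j) a) 0 _)
      | succ b =>
        haveI : Subsingleton (groupCohomology (ZSC U D.B a).X₂ (b + 1)) :=
          ModuleCat.subsingleton_of_isZero
            (isZero_groupCohomology_funRep_succ D.B (Nerve U a) (t a) (hbij a) b)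
        have hu0 : u = 0 := Subsingleton.elim u 0
        rw [hu0, map_zero] at hu
        obtain ⟨j, hij, hj⟩ := ihI i w hu.symm
        refine ⟨j, hij, (hnat (D.t hij) w).trans ?_⟩
        exact (congrArg (δ (hZ (D.A j) a) (b + 1) (b + 1 + 1) rfl) hj).trans (map_zero _)

include hU hcov hgood hbij in
/-- **(F) for all pieces**: `Hᵇ(S, Z_a(A))` is finitely generated for `A` finitely generated over
Noetherian `k` (`H⁰(Z_a(A)) ↪ Fun(T_a, A)`, and `δ` is surjective).
[cite: Brown1982CohomologyGroups, VII (7.10); VIII.4 Ex. 1] -/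
theorem moduleFinite_groupCohomology_Zrep [IsNoetherianRing k] (A : Rep.{u} k S) [Module.Finite k A] :
    ∀ b a : ℕ, Module.Finite k (groupCohomology (Zrep U A a) b) := by
  have hZ : ∀ a : ℕ, (ZSC U A a).ShortExact := fun a => ZSC_shortExact U A hU hcov hgood a
  intro b
  induction b with
  | zero =>
    intro a
    -- `H⁰(Z_a(A)) → Fun(T_a, A)`, evaluation of the invariant cocycle on the section
    let ev : groupCohomology (Zrep U A a) 0 →ₗ[k] (T a → A) :=
      LinearMap.funLeft k A (t a) ∘ₗ (LinearMap.ker (cechRepD U A a).hom.toLinearMap).subtype ∘ₗ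
        (Zrep U A a).ρ.invariants.subtype ∘ₗ (H0Iso (Zrep U A a)).toLinearEquiv.toLinearMap
    have hev : ∀ (x : groupCohomology (Zrep U A a) 0) (r : T a),
        ev x r = (((H0Iso (Zrep U A a)).hom x).1.1 : Nerve U a → A) (t a r) := fun x r => rfl
    have hinv : ∀ w : (Zrep U A a).ρ.invariants,
        ((w.1.1 : Nerve U a → A)) ∈ (funRep A (Nerve U a)).ρ.invariants := by
      intro w
      rw [Representation.mem_invariants]
      intro g
      have h1 := (Representation.mem_invariants _ _).1 w.2 g
      have h2 := congrArg (fun v : Zrep U A a => (Zι U A a).hom v) h1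
      rw [Rep.hom_comm_apply] at h2
      exact h2
    have hinj : Function.Injective ev := by
      intro x y h
      apply (H0Iso (Zrep U A a)).toLinearEquiv.injective
      change (H0Iso _).hom x = (H0Iso _).hom y
      apply Subtype.ext
      apply Subtype.ext
      refine eq_of_mem_invariants_of_forall_eq A (Nerve U a) (t a) (hbij a) (hinv _) (hinv _) fun r => ?_
      rw [← hev, ← hev, h]
    haveI : Module.Finite k (T a → A) := Module.Finite.pi
    exact Module.Finite.of_injective ev hinj
  | succ b ih =>
    intro a
    haveI : Module.Finite k (groupCohomology (ZSC U A a).X₃ b) := ih (a + 1)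
    exact Module.Finite.of_surjective (δ (hZ a) b (b + 1) rfl).hom
      (δ_surjective_of_isZero (hZ a) b (isZero_groupCohomology_funRep_succ A (Nerve U a) (t a) (hbij a) b))

include hU hcov hgood hbij in
/-- **Brown's criterion, finite-type form.**  An equivariant good open cover of a contractible
`S`-space whose nerve is a free `S`-set with finitely many orbits in each degree makes `Hⁿ(S, -)`
of finite type over EVERY commutative ring `k`: finitely generated on finitely generated
coefficients (`k` Noetherian) and commuting with directed unions of subrepresentations (both
halves), i.e. `IsCohFiniteTypeUpTo k S 1`. [cite: Brown1982CohomologyGroups, VII (7.10), VIII (4.6), (4.8)] -/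
theorem isCohFiniteTypeUpTo_one_of_freeGoodCover : IsCohFiniteTypeUpTo k S 1 where
  moduleFinite A _ n := by
    have hfin : Module.Finite k (groupCohomology (Zrep U A 0) n) :=
      moduleFinite_groupCohomology_Zrep U hU hcov hgood t hbij A n 0
    haveI := isIso_Zε U A hU hcov
    let e : groupCohomology A n ≅ groupCohomology (Zrep U A 0) n :=
      (groupCohomology.functor k S n).mapIso (asIso (Zε U A))
    haveI := hfin
    exact Module.Finite.equiv e.toLinearEquiv.symm
  exists_map_eq D n x := by
    obtain ⟨i, y', hy'⟩ := (surj_and_inj_Zrep U hU hcov hgood t hbij D n 0).1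
      (groupCohomology.map (MonoidHom.id S) (Zε U D.B) n x)
    haveI := isIso_Zε U (D.A i) hU hcov
    haveI := isIso_Zε U D.B hU hcov
    let eA := (groupCohomology.functor k S n).mapIso (asIso (Zε U (D.A i)))
    let eB := (groupCohomology.functor k S n).mapIso (asIso (Zε U D.B))
    refine ⟨i, eA.inv y', ?_⟩
    rw [one_smul]
    apply eB.toLinearEquiv.injective
    change groupCohomology.map (MonoidHom.id S) (Zε U D.B) n
        (groupCohomology.map (MonoidHom.id S) (D.φ i) n (eA.inv y')) =
      groupCohomology.map (MonoidHom.id S) (Zε U D.B) n x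
    rw [map_map_eq_of_comp_eq (Zε_naturality U (D.φ i)) n]
    change groupCohomology.map (MonoidHom.id S) (Zmap U (D.φ i) 0) n (eA.hom (eA.inv y')) = _
    rw [iso_hom_inv_apply, hy']
  exists_map_eq_zero D n i y hy := by
    haveI := fun E : Rep.{u} k S => isIso_Zε U E hU hcov
    let e := fun E : Rep.{u} k S => (groupCohomology.functor k S n).mapIso (asIso (Zε U E))
    have hy' : groupCohomology.map (MonoidHom.id S) (Zmap U (D.φ i) 0) n ((e (D.A i)).hom y) = 0 := by
      change groupCohomology.map (MonoidHom.id S) (Zmap U (D.φ i) 0) n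
        (groupCohomology.map (MonoidHom.id S) (Zε U (D.A i)) n y) = 0
      rw [← map_map_eq_of_comp_eq (Zε_naturality U (D.φ i)) n, hy, map_zero]
    obtain ⟨j, hij, hj⟩ := (surj_and_inj_Zrep U hU hcov hgood t hbij D n 0).2 i _ hy'
    refine ⟨j, hij, ?_⟩
    rw [one_smul]
    apply (e (D.A j)).toLinearEquiv.injective
    change groupCohomology.map (MonoidHom.id S) (Zε U (D.A j)) n
        (groupCohomology.map (MonoidHom.id S) (D.t hij) n y) = (e (D.A j)).hom 0
    rw [map_zero, map_map_eq_of_comp_eq (Zε_naturality U (D.t hij)) n]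
    exact hj

end Main

/-! ### Covers by translates of finitely many prototypes -/

/-- **A finiteness witness for `S` in the form of Brown's criterion with a translate cover**: a
continuous action on a contractible space, finitely many open prototypes `V_b` whose translates
cover, all non-empty finite intersections of translates contractible, and pairwise local
finiteness `#{g | g V_b ∩ V_{b'} ≠ ∅} < ∞` — exactly the hypotheses of
`finite_groupCohomology_of_translateCover`.  (For `S = GL₂(𝓞_K)`, `K` imaginary quadratic: the
cone of binary Hermitian forms covered by translates of finitely many boxes and cusp boxes,
[ElstrodtGrunewaldMennicke1998, Ch. 7 §7.3]; in general [BorelSerre1973, §11.1].)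
[cite: Brown1982CohomologyGroups, VII (7.10); VIII §2] -/
structure GoodTranslateCover (S : Type u) [Group S] where
  /-- the space -/
  X : Type u
  /-- its topology -/
  [top : TopologicalSpace X]
  /-- the action -/
  [act : MulAction S X]
  /-- the action is by homeomorphisms -/
  [cont : ContinuousConstSMul S X]
  /-- the space is contractible -/
  [contr : ContractibleSpace X]
  /-- the (finite) type of prototypes -/
  B : Type u
  /-- finitely many prototypes -/
  [fin : Finite B]
  /-- the prototypes -/
  V : B → Set X
  /-- the prototypes are open -/
  isOpen : ∀ b, IsOpen (V b)
  /-- the translates cover -/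
  cover : ∀ x : X, ∃ (g : S) (b : B), x ∈ g • V b
  /-- non-empty finite intersections of translates are contractible -/
  good : ∀ (p : ℕ) (J : Fin (p + 1) → TIdx S B), (cechSet (translCover (S := S) V) J).Nonempty →
    ContractibleSpace ↥(cechSet (translCover (S := S) V) J)
  /-- pairwise local finiteness -/
  locFinite : ∀ b b' : B, {g : S | (g • V b ∩ V b').Nonempty}.Finite

attribute [instance] GoodTranslateCover.top GoodTranslateCover.act GoodTranslateCover.cont
  GoodTranslateCover.contr GoodTranslateCover.fin

/-- **A good translate cover makes `Hⁿ(S, -)` of finite type over every `k`** (the nerve of the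
translates is a free `S`-set with finitely many orbits in each degree, `nerve_bijective`,
`finite_nerveRep`). [cite: Brown1982CohomologyGroups, VII (7.10), VIII (4.6), (4.8)] -/
theorem isCohFiniteTypeUpTo_one_of_goodTranslateCover (W : GoodTranslateCover S) (k : Type u)
    [CommRing k] : IsCohFiniteTypeUpTo k S 1 := by
  haveI : ∀ p, Finite (NerveRep (S := S) W.V p) := fun p => finite_nerveRep W.V W.locFinite p
  exact isCohFiniteTypeUpTo_one_of_freeGoodCover (translCover (S := S) W.V)
    (fun i => (W.isOpen i.b).smul i.g)
    (fun x _ => by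
      obtain ⟨g, b, hx⟩ := W.cover x
      exact Set.mem_iUnion.2 ⟨⟨g, b⟩, hx⟩)
    W.good (fun p (J : NerveRep (S := S) W.V p) => (J : Nerve (translCover (S := S) W.V) p))
    (fun p => nerve_bijective W.V p)



end Literature.Algebra.Homology
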